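import Mathlib
import HarnessLib.Audit
import Summits.PneNP.PneNP.Theorems.PstarGapOneAll
import Summits.PneNP.PneNP.Theorems.PstarGapOneAnd
import Summits.PneNP.PneNP.Theorems.PstarChordEndgameTools

/-!
# The chord endgame of the reader-graph induction (ROUND-24, item T24.17′ `GSat`, case (e))

FRONTIER range-avoidance ladder, rung F-N3, ROUND 24 (cell `pnp-ideate`; restricted-model proof complexity — nothing here bears
on `P` versus `NP`).

The planner's reader-graph induction for `PstarGapOneAll.GSat` (memo ROUND-24-PRESEED §13 R10(p)) ends, in the branch where the
minimal unsatisfiable output set `J` contains a CHORD (an output whose two AND slots are `J`-private), with a finite endgame: the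
chord step (c) has already shown that no XOR slot of `J` is `J`-private, that every monomial pair of the G-constraint meets the AND
pair of every chord, and that every variable of its linear part outside a chord's pair lies in some monomial pair.  This file
proves that endgame as a STANDALONE lemma (`chord_endgame`), in the vocabulary of `PstarGapOneAll.gval`, so that the assembly of
`GSat` can call it:

* counting (`three_card_le`): with no private XOR slot, the boundary of `J` consists of private AND slots, so `(3/2)`-expansion
  reads `3|J| ≤ 2·Σ_f #(private AND slots of f)`, a chord contributing `2`, a non-chord `≤ 1`;
* three or more chords are impossible (`no_three_chords`): their AND pairs are pairwise disjoint, a two-element monomial pair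
  cannot meet three of them, so `G = ∅`, then `C = ∅`, and the G-constraint would be constant;
* a chord forces `|J| ≥ 3` (`three_le_card`): its XOR slots are read elsewhere in `J`, by two different outputs (simple overlaps);
* hence exactly two chords `g₁, g₂`, at most two further outputs, each owning one private AND slot (a LEAF) — and then an explicit
  solution (`solve_two_chords`): choose the XOR variables so that both chords demand AND-bit `0` (their XOR pairs differ, by simple
  overlaps), put every other variable at `true`, tune each leaf, and run the two chord pairs over the patterns `{00, 10, 01}²`, on
  which the G-constraint — supported on the four chord slots — takes both values (all off: `0`; one `C`-slot on, or the two ends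
  of one monomial pair on: `1`; the referee's cares P1/P2 of AUDIT-r10p-gsat-g43 are the case splits here).

Uses `IsPure` (injective slots), `Typed`, `SimpleOverlap`, boundary expansion of `J` itself; not `MaxDegree`, not `Disjoint J G`.
-/

set_option linter.dupNamespace false

open Finset Literature.Computability.Complexity
open Summit.PneNP.PneNP.Theorems.PstarPDT (parity)
open Summit.PneNP.PneNP.Theorems.PstarTyped (Typed)
open Summit.PneNP.PneNP.Theorems.PstarSALevel (varSet bdry BoundaryExpanding SimpleOverlap)
open Summit.PneNP.PneNP.Theorems.PstarGapPeeling (eval_pure)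
open Summit.PneNP.PneNP.Theorems.PstarGapLinearised (andPair andPair_subset_varSet)
open Summit.PneNP.PneNP.Theorems.PstarGapOneAll (gval)
open Summit.PneNP.PneNP.Theorems.PstarChordRepair (IsChord)
open Summit.PneNP.PneNP.Theorems.PstarCentreFree (vars_mem_varSet)
open Summit.PneNP.PneNP.Theorems.PstarGapOneKills (exists_other_reader eq_of_bdry mem_andPair_of_slot)
open Summit.PneNP.PneNP.Theorems.PstarChordEndgameTools

namespace Summit.PneNP.PneNP.Theorems.PstarChordEndgame

variable {n m : ℕ}

/-! ## The explicit solution with two chords -/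

section TwoChords

variable (I : LocalMap 4 n m) (hI : I.IsPure xorAndPred) (hT : Typed I) (hS : SimpleOverlap I)
  {J G : Finset (Fin m)} {C : Finset (Fin n)} {y : Fin m → Bool} {g₁ g₂ : Fin m}
  (hg₁ : g₁ ∈ J) (hg₂ : g₂ ∈ J) (hc₁ : IsChord I J g₁) (hc₂ : IsChord I J g₂) (h₁₂ : g₁ ≠ g₂)
  (honly : ∀ g ∈ J, IsChord I J g → g = g₁ ∨ g = g₂)
  (hleaf : ∀ f ∈ J, ¬ IsChord I J f → I.vars f 2 ∈ bdry I J ∨ I.vars f 3 ∈ bdry I J)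
  (hmeet : ∀ g ∈ J, IsChord I J g → ∀ π ∈ G, ¬ Disjoint (andPair I π) (andPair I g))
  (hCsub : ∀ g ∈ J, IsChord I J g → ∀ v ∈ C, v ∉ andPair I g → ∃ π ∈ G, v ∈ andPair I π)


include hI hT hS hg₁ hg₂ hc₁ hc₂ h₁₂ honly hleaf hmeet hCsub in
/-- **Solving `J` along a pattern.**  For every set `On` of chord slots switching on at most one slot of each chord, some
assignment solves all of `J` and realises the indicator of `On` on the chord slots, with
`gval = [|C ∩ On| odd] ⊕ [#{π ∈ G : pair π ⊆ On} odd]`. -/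
theorem solve_pattern (On : Finset (Fin n)) (hOn : On ⊆ andPair I g₁ ∪ andPair I g₂)
    (hZ₁ : ¬ (I.vars g₁ 2 ∈ On ∧ I.vars g₁ 3 ∈ On)) (hZ₂ : ¬ (I.vars g₂ 2 ∈ On ∧ I.vars g₂ 3 ∈ On)) :
    ∃ z : Fin n → Bool, (∀ j ∈ J, I.eval z j = y j) ∧
      gval I C G z = xor (decide (Odd (C.filter fun v => v ∈ On).card))
        (decide (Odd (G.filter fun π => andPair I π ⊆ On).card)) := by
  classical
  -- names
  set S := andPair I g₁ ∪ andPair I g₂ with hSdef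
  set R := J.filter fun f => ¬ IsChord I J f with hRdef
  have hRJ : ∀ f ∈ R, f ∈ J := fun f hf => (mem_filter.1 hf).1
  have hRnc : ∀ f ∈ R, ¬ IsChord I J f := fun f hf => (mem_filter.1 hf).2
  have hSb : S ⊆ bdry I J := union_subset (andPair_subset_bdry_of_isChord I hc₁) (andPair_subset_bdry_of_isChord I hc₂)
  -- elements of `S` are read by a chord only
  have hSreader : ∀ v ∈ S, ∀ f ∈ J, v ∈ varSet I f → IsChord I J f := by
    intro v hv f hf hvf
    rcases mem_union.1 hv with h | h
    · rw [eq_of_bdry I (hSb hv) hf hg₁ hvf (andPair_subset_varSet I g₁ h)]; exact hc₁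
    · rw [eq_of_bdry I (hSb hv) hf hg₂ hvf (andPair_subset_varSet I g₂ h)]; exact hc₂
  -- elements of `S` and leaves are AND-slot variables; XOR-slot variables avoid them
  have hSand : ∀ v ∈ S, ∃ g : Fin m, ∃ s : Fin 4, 2 ≤ s.val ∧ I.vars g s = v := by
    intro v hv
    rcases mem_union.1 hv with h | h
    · obtain ⟨s, hs, hsv⟩ := exists_slot_of_mem_andPair I h; exact ⟨g₁, s, hs, hsv⟩
    · obtain ⟨s, hs, hsv⟩ := exists_slot_of_mem_andPair I h; exact ⟨g₂, s, hs, hsv⟩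
  have hxS : ∀ (j : Fin m) (s : Fin 4), s.val < 2 → I.vars j s ∉ S := by
    intro j s hs hv
    obtain ⟨g, s', hs', hse⟩ := hSand _ hv
    exact hT j g s s' hs hs' hse.symm
  have hxℓ : ∀ (j : Fin m) (s : Fin 4), s.val < 2 → ∀ f : Fin m, leaf I J f ≠ I.vars j s := by
    intro j s hs f h
    obtain ⟨s', hs', hse⟩ := leaf_slot I J f
    exact hT j f s s' hs hs' (h ▸ hse).symm
  -- the XOR values
  set u₁ := I.vars g₁ 0 with hu₁
  set v₁ := I.vars g₁ 1 with hv₁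
  set u₂ := I.vars g₂ 0 with hu₂
  set v₂ := I.vars g₂ 1 with hv₂
  have n₁ : u₁ ≠ v₁ := fun h => absurd (hI.2 g₁ h) (by decide)
  have n₂ : u₂ ≠ v₂ := fun h => absurd (hI.2 g₂ h) (by decide)
  have hpairs : ¬ ((u₁ = u₂ ∨ u₁ = v₂) ∧ (v₁ = u₂ ∨ v₁ = v₂)) := by
    rintro ⟨hu, hv⟩
    have hu' : u₁ ∈ varSet I g₂ := by
      rcases hu with h | h
      · rw [h]; exact vars_mem_varSet I g₂ 0
      · rw [h]; exact vars_mem_varSet I g₂ 1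
    have hv' : v₁ ∈ varSet I g₂ := by
      rcases hv with h | h
      · rw [h]; exact vars_mem_varSet I g₂ 0
      · rw [h]; exact vars_mem_varSet I g₂ 1
    exact not_two_shared I hS h₁₂ n₁ (vars_mem_varSet I g₁ 0) hu' (vars_mem_varSet I g₁ 1) hv'
  obtain ⟨x, hx₁, hx₂, hxother⟩ := exists_xor_assignment u₁ v₁ u₂ v₂ n₁ n₂ hpairs (y g₁) (y g₂)
  -- the protected variables: XOR slots and coleaves of `J`
  set P := (J.biUnion fun j => ({I.vars j 0, I.vars j 1} : Finset (Fin n))) ∪ R.image (coleaf I J) with hPdef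
  have hPx : ∀ j ∈ J, ∀ s : Fin 4, s.val < 2 → I.vars j s ∈ P := by
    intro j hj s hs
    refine mem_union_left _ (mem_biUnion.2 ⟨j, hj, ?_⟩)
    have : s = 0 ∨ s = 1 := by fin_cases s <;> simp at hs ⊢
    rcases this with rfl | rfl <;> simp
  have hPco : ∀ f ∈ R, coleaf I J f ∈ P := fun f hf => mem_union_right _ (mem_image_of_mem _ hf)
  have hPS : Disjoint P S := by
    rw [disjoint_left]
    intro v hvP hvS
    rcases mem_union.1 hvP with h | h
    · obtain ⟨j, -, hj⟩ := mem_biUnion.1 h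
      rw [mem_insert, mem_singleton] at hj
      rcases hj with rfl | rfl
      · exact hxS j 0 (by decide) hvS
      · exact hxS j 1 (by decide) hvS
    · obtain ⟨f, hf, rfl⟩ := mem_image.1 h
      exact (leaf_mem_bdry I hleaf (hRJ f hf) (hRnc f hf)).2 (hSb hvS)
  have hPℓ : ∀ f ∈ R, leaf I J f ∉ P := by
    intro f hf h
    rcases mem_union.1 h with h | h
    · obtain ⟨j, -, hj⟩ := mem_biUnion.1 h
      rw [mem_insert, mem_singleton] at hj
      rcases hj with h' | h'
      · exact hxℓ j 0 (by decide) f h'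
      · exact hxℓ j 1 (by decide) f h'
    · obtain ⟨f', hf', hff'⟩ := mem_image.1 h
      exact (leaf_mem_bdry I hleaf (hRJ f' hf') (hRnc f' hf')).2 (hff' ▸ (leaf_mem_bdry I hleaf (hRJ f hf) (hRnc f hf)).1)
  have hℓS : ∀ f ∈ R, leaf I J f ∉ S := by
    intro f hf h
    obtain ⟨s, -, hse⟩ := leaf_slot I J f
    exact hRnc f hf (hSreader _ h f (hRJ f hf) (hse ▸ vars_mem_varSet I f s))
  have hℓinj : ∀ f ∈ R, ∀ f' ∈ R, leaf I J f = leaf I J f' → f = f' := by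
    intro f hf f' hf' h
    obtain ⟨s, -, hse⟩ := leaf_slot I J f
    obtain ⟨s', -, hse'⟩ := leaf_slot I J f'
    exact eq_of_bdry I (leaf_mem_bdry I hleaf (hRJ f hf) (hRnc f hf)).1 (hRJ f hf) (hRJ f' hf')
      (hse ▸ vars_mem_varSet I f s) (h ▸ hse' ▸ vars_mem_varSet I f' s')
  -- the assignment
  set cval : Fin m → Bool := fun f => xor (xor (x (I.vars f 0)) (x (I.vars f 1))) (y f) with hcval
  obtain ⟨z, hzS, hzP, hzℓ⟩ := exists_assignment S On R (leaf I J) cval x P hPS hPℓ hℓS hℓinj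
  have hzx : ∀ j ∈ J, ∀ s : Fin 4, s.val < 2 → z (I.vars j s) = x (I.vars j s) := fun j hj s hs => hzP _ (hPx j hj s hs)
  -- coleaves sit at `true`
  have hzco : ∀ f ∈ R, z (coleaf I J f) = true := by
    intro f hf
    rw [hzP _ (hPco f hf)]
    obtain ⟨s, hs, hse⟩ := coleaf_slot I J f
    refine hxother _ ?_ ?_ ?_ ?_ <;> rw [← hse]
    · exact fun h => hT g₁ f 0 s (by decide) hs h.symm
    · exact fun h => hT g₁ f 1 s (by decide) hs h.symm
    · exact fun h => hT g₂ f 0 s (by decide) hs h.symm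
    · exact fun h => hT g₂ f 1 s (by decide) hs h.symm
  refine ⟨z, fun j hj => ?_, gval_pattern I hzS (C_subset I hg₁ hg₂ hc₁ hc₂ h₁₂ hmeet hCsub)
    fun π hπ => (gpair_subset I hg₁ hg₂ hc₁ hc₂ h₁₂ hmeet hπ).1⟩
  by_cases hjc : IsChord I J j
  · -- a chord: its XOR side carries `y`, its AND pair sits in `{00, 10, 01}`
    have hand : ∀ g : Fin m, ¬ (I.vars g 2 ∈ On ∧ I.vars g 3 ∈ On) → andPair I g ⊆ S →
        (z (I.vars g 2) && z (I.vars g 3)) = false := by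
      intro g hZ hgS
      rw [hzS _ (hgS (mem_andPair_of_slot I g 2 (by decide))), hzS _ (hgS (mem_andPair_of_slot I g 3 (by decide)))]
      by_cases h2 : I.vars g 2 ∈ On
      · have h3 : I.vars g 3 ∉ On := fun h3 => hZ ⟨h2, h3⟩
        simp [h3]
      · simp [h2]
    rcases honly j hj hjc with rfl | rfl
    · rw [eval_pure I hI, hand j hZ₁ subset_union_left, hzx j hj 0 (by decide), hzx j hj 1 (by decide), Bool.xor_false]
      exact hx₁
    · rw [eval_pure I hI, hand j hZ₂ subset_union_right, hzx j hj 0 (by decide), hzx j hj 1 (by decide), Bool.xor_false]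
      exact hx₂
  · -- a non-chord: the coleaf is `true`, the leaf is tuned
    have hjR : j ∈ R := mem_filter.2 ⟨hj, hjc⟩
    have hcj : cval j = xor (xor (x (I.vars j 0)) (x (I.vars j 1))) (y j) := rfl
    rw [eval_leaf I hI J, hzℓ j hjR, hzco j hjR, hzx j hj 0 (by decide), hzx j hj 1 (by decide), Bool.and_true, hcj]
    cases x (I.vars j 0) <;> cases x (I.vars j 1) <;> cases y j <;> rfl

include hI hT hS hg₁ hg₂ hc₁ hc₂ h₁₂ honly hleaf hmeet hCsub in
/-- **The two-chord case is satisfiable**, for either target value of the (non-constant) G-constraint. -/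
theorem solve_two_chords (hnc : ∃ z z' : Fin n → Bool, gval I C G z ≠ gval I C G z') (b : Bool) :
    ∃ z : Fin n → Bool, (∀ j ∈ J, I.eval z j = y j) ∧ gval I C G z = b := by
  classical
  have h23 : ∀ g : Fin m, I.vars g 2 ≠ I.vars g 3 := fun g h => absurd (hI.2 g h) (by decide)
  -- all off: value `false`
  have hoff : ∃ z : Fin n → Bool, (∀ j ∈ J, I.eval z j = y j) ∧ gval I C G z = false := by
    obtain ⟨z, hz, hg⟩ := solve_pattern I hI hT hS hg₁ hg₂ hc₁ hc₂ h₁₂ honly hleaf hmeet hCsub ∅ (empty_subset _)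
      (by simp) (by simp)
    refine ⟨z, hz, ?_⟩
    rw [hg]
    have hC0 : (C.filter fun v => v ∈ (∅ : Finset (Fin n))) = ∅ := by ext v; simp
    have hG0 : (G.filter fun π => andPair I π ⊆ (∅ : Finset (Fin n))) = ∅ := by
      ext π
      simp only [mem_filter, subset_empty, notMem_empty, iff_false, not_and]
      intro _ h
      have := card_andPair I hI π
      rw [h, card_empty] at this
      exact absurd this (by decide)
    rw [hC0, hG0]
    simp
  cases b with
  | false => exact hoff
  | true =>
    by_cases hC : C.Nonempty
    · -- one `C`-slot on: value `true`
      obtain ⟨v, hv⟩ := hC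
      have hvS := C_subset I hg₁ hg₂ hc₁ hc₂ h₁₂ hmeet hCsub hv
      obtain ⟨z, hz, hg⟩ := solve_pattern I hI hT hS hg₁ hg₂ hc₁ hc₂ h₁₂ honly hleaf hmeet hCsub {v}
        (singleton_subset_iff.2 hvS)
        (by simp only [mem_singleton]; exact fun ⟨h2, h3⟩ => h23 g₁ (h2.trans h3.symm))
        (by simp only [mem_singleton]; exact fun ⟨h2, h3⟩ => h23 g₂ (h2.trans h3.symm))
      refine ⟨z, hz, ?_⟩
      rw [hg]
      have hC1 : (C.filter fun w => w ∈ ({v} : Finset (Fin n))) = {v} := by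
        ext w; simp only [mem_filter, mem_singleton]; exact ⟨fun h => h.2, fun h => ⟨h ▸ hv, h⟩⟩
      have hG0 : (G.filter fun π => andPair I π ⊆ ({v} : Finset (Fin n))) = ∅ := by
        ext π
        simp only [mem_filter, notMem_empty, iff_false, not_and]
        intro _ h
        have := (card_le_card h).trans_eq (card_singleton v)
        have := card_andPair I hI π
        omega
      rw [hC1, hG0]
      simp
    · -- `C = ∅`: some monomial pair exists (else the constraint is constant); switch its two ends on: value `true`
      rw [not_nonempty_iff_eq_empty] at hC
      subst hC
      have hG : G.Nonempty := by
        rw [nonempty_iff_ne_empty]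
        rintro rfl
        obtain ⟨z, z', hzz'⟩ := hnc
        apply hzz'
        simp [PstarGapOneAll.gval, PstarPDT.parity]
      obtain ⟨π₀, hπ₀⟩ := hG
      obtain ⟨hπS, hn₁, hn₂⟩ := gpair_subset I hg₁ hg₂ hc₁ hc₂ h₁₂ hmeet hπ₀
      have hZ : ∀ g : Fin m, ¬ (andPair I π₀ ⊆ andPair I g) → ¬ (I.vars g 2 ∈ andPair I π₀ ∧ I.vars g 3 ∈ andPair I π₀) := by
        rintro g hng ⟨h2, h3⟩
        apply hng
        have hsub : andPair I g ⊆ andPair I π₀ := by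
          intro w hw
          rw [mem_andPair_iff] at hw
          rcases hw with rfl | rfl
          · exact h2
          · exact h3
        rw [eq_of_subset_of_card_le hsub (by rw [card_andPair I hI, card_andPair I hI])]
      obtain ⟨z, hz, hg⟩ := solve_pattern I hI hT hS hg₁ hg₂ hc₁ hc₂ h₁₂ honly hleaf hmeet hCsub (andPair I π₀) hπS
        (hZ g₁ hn₁) (hZ g₂ hn₂)
      refine ⟨z, hz, ?_⟩
      rw [hg]
      have hG1 : (G.filter fun π => andPair I π ⊆ andPair I π₀) = {π₀} := by
        ext π
        simp only [mem_filter, mem_singleton]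
        constructor
        · rintro ⟨-, h⟩
          exact eq_of_andPair_subset I hI hS h
        · rintro rfl
          exact ⟨hπ₀, Subset.rfl⟩
      rw [hG1]
      simp

end TwoChords

/-! ## The endgame -/

/-- **The chord endgame of the reader-graph induction (memo R10(p), case (e)).**  On a pure typed instance with simple overlaps,
let `J` (`|J| ≤ r`, inside the boundary-expansion range) contain a chord and have no private XOR slot, and let the non-constant
G-constraint `(C, G)` be such that every monomial pair meets the AND pair of every chord and every `C`-variable outside a chord's
pair lies in a monomial pair (the outputs of the chord step (c)).  Then `J` is solvable together with `gval = b`, for both `b`. -/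
theorem chord_endgame (I : LocalMap 4 n m) (hI : I.IsPure xorAndPred) (hT : Typed I) (hS : SimpleOverlap I) {r : ℕ}
    (hB : BoundaryExpanding r I) {J : Finset (Fin m)} (hJr : J.card ≤ r) (G : Finset (Fin m)) (C : Finset (Fin n))
    (y : Fin m → Bool) (b : Bool)
    (hnc : ∃ z z' : Fin n → Bool, gval I C G z ≠ gval I C G z')
    (hch : ∃ g ∈ J, IsChord I J g)
    (hnx : ∀ g ∈ J, ∀ s : Fin 4, s.val < 2 → I.vars g s ∉ bdry I J)
    (hmeet : ∀ g ∈ J, IsChord I J g → ∀ π ∈ G, ¬ Disjoint (andPair I π) (andPair I g))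
    (hCsub : ∀ g ∈ J, IsChord I J g → ∀ v ∈ C, v ∉ andPair I g → ∃ π ∈ G, v ∈ andPair I π) :
    ∃ z : Fin n → Bool, (∀ j ∈ J, I.eval z j = y j) ∧ gval I C G z = b := by
  classical
  set Ch := J.filter fun g => IsChord I J g with hCh
  have hChJ : Ch ⊆ J := filter_subset _ _
  -- counting: `3|J| ≤ 2 (2 #Ch + Σ_{non-chords} #privAnd)`
  have hcount := three_card_le I J hB hJr hnx
  have hsplit : ∑ f ∈ J, (privAnd I J f).card =
      ∑ f ∈ Ch, (privAnd I J f).card + ∑ f ∈ J.filter (fun g => ¬ IsChord I J g), (privAnd I J f).card := by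
    rw [hCh, sum_filter_add_sum_filter_not]
  have hChsum : ∑ f ∈ Ch, (privAnd I J f).card ≤ 2 * Ch.card := by
    calc ∑ f ∈ Ch, (privAnd I J f).card ≤ ∑ _f ∈ Ch, 2 := sum_le_sum fun f _ => card_privAnd_le_two I J f
      _ = 2 * Ch.card := by rw [sum_const, smul_eq_mul, mul_comm]
  have hRsum : ∑ f ∈ J.filter (fun g => ¬ IsChord I J g), (privAnd I J f).card ≤ (J.filter fun g => ¬ IsChord I J g).card := by
    calc ∑ f ∈ J.filter (fun g => ¬ IsChord I J g), (privAnd I J f).card ≤ ∑ _f ∈ J.filter (fun g => ¬ IsChord I J g), 1 :=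
          sum_le_sum fun f hf => card_privAnd_le_one I J (mem_filter.1 hf).2
      _ = _ := by rw [sum_const, smul_eq_mul, mul_one]
  have hJcard : J.card = Ch.card + (J.filter fun g => ¬ IsChord I J g).card := by
    rw [hCh, card_filter_add_card_filter_not]
  -- not three chords
  by_cases h3 : 3 ≤ Ch.card
  · exfalso
    obtain ⟨g₁, g₂, g₃, hg₁, hg₂, hg₃, h₁₂, h₁₃, h₂₃⟩ := two_lt_card_iff.1 h3
    exact no_three_chords I (hChJ hg₁) (hChJ hg₂) (hChJ hg₃) (mem_filter.1 hg₁).2 (mem_filter.1 hg₂).2 (mem_filter.1 hg₃).2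
      h₁₂ h₁₃ h₂₃ hnc hmeet hCsub
  push Not at h3
  -- at least three outputs, hence exactly two chords
  obtain ⟨g, hg, hcg⟩ := hch
  have hJ3 := three_le_card I hI hS hg hnx
  have hCh2 : Ch.card = 2 := by omega
  obtain ⟨g₁, g₂, h₁₂, hCheq⟩ := card_eq_two.1 hCh2
  have hg₁ : g₁ ∈ Ch := by rw [hCheq]; simp
  have hg₂ : g₂ ∈ Ch := by rw [hCheq]; simp
  have honly : ∀ g ∈ J, IsChord I J g → g = g₁ ∨ g = g₂ := by
    intro g hg hcg
    have : g ∈ Ch := mem_filter.2 ⟨hg, hcg⟩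
    rw [hCheq, mem_insert, mem_singleton] at this
    exact this
  -- every non-chord owns a private AND slot (else the count fails)
  have hleaf : ∀ f ∈ J, ¬ IsChord I J f → I.vars f 2 ∈ bdry I J ∨ I.vars f 3 ∈ bdry I J := by
    intro f hf hfc
    by_contra hno
    push Not at hno
    have hfR : f ∈ J.filter fun g => ¬ IsChord I J g := mem_filter.2 ⟨hf, hfc⟩
    have h0 : (privAnd I J f).card = 0 := by rw [privAnd_eq_empty I J hno.1 hno.2, card_empty]
    have hRsum' : ∑ f ∈ J.filter (fun g => ¬ IsChord I J g), (privAnd I J f).card + 1 ≤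
        (J.filter fun g => ¬ IsChord I J g).card := by
      rw [← add_sum_erase _ _ hfR, h0, zero_add]
      calc ∑ f ∈ (J.filter fun g => ¬ IsChord I J g).erase f, (privAnd I J f).card + 1
          ≤ ∑ _f ∈ (J.filter fun g => ¬ IsChord I J g).erase f, 1 + 1 :=
            Nat.add_le_add_right (sum_le_sum fun f' hf' => card_privAnd_le_one I J (mem_filter.1 (mem_of_mem_erase hf')).2) 1
        _ = _ := by rw [sum_const, smul_eq_mul, mul_one, card_erase_add_one hfR]
    omega
  exact solve_two_chords I hI hT hS (hChJ hg₁) (hChJ hg₂) (mem_filter.1 hg₁).2 (mem_filter.1 hg₂).2 h₁₂ honly hleaf hmeet hCsub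
    hnc b

end Summit.PneNP.PneNP.Theorems.PstarChordEndgame
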